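import Literature.MathematicalPhysics.QuantumManyBody.BoseEinsteinCondensation
import Literature.Probability.Divergences.KLDivConvexity
import Mathlib.InformationTheory.KullbackLeibler.Basic

/-!
# Route `BECThomsonPrinciple`, crux `PeriodicToDirichlet` (stmt-AtomisticToContinuum-9483),
# line `Sketch` (torus-in-the-box-doob): registered stub `stub_entropyEventBound`

Yau's lever (Kipnis–Landim App. 1 Prop. 8.2): a law `Q` of finite relative entropy w.r.t. `P` cannot
charge a `P`-rare event — `Q(A) · log(1 + 1/P(A)) ≤ log 2 + KL(Q‖P)`. Proof: the log-form
Donsker–Varadhan inequality `∫ ψ dQ ≤ KL(Q‖P) + log ∫ e^ψ dP` (tree: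
`Literature.Probability.Divergences.integral_le_toReal_klDiv_add_log`) with the bounded measurable
`ψ = log(1 + 1/P(A)) · 1_A`, for which `∫ e^ψ dP = P(Aᶜ) + P(A)(1 + 1/P(A)) = 2`. Stated on the
configuration spaces `Config N` of the Bose gas (where the line uses it). [folklore]
-/

noncomputable section

open MeasureTheory Filter
open scoped ENNReal NNReal

namespace Summit.AtomisticToContinuum.BoseEinsteinCondensation.TorusInTheBox

open Literature.MathematicalPhysics.QuantumManyBody.BoseGas

/-- **Registered stub `stub_entropyEventBound`** (line `Sketch` of crux stmt-AtomisticToContinuum-9483;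
the skeleton's `EntropyEventBound`). [folklore] -/
theorem stub_entropyEventBound :
    ∀ (N : ℕ) (Q P : Measure (Config N)), IsProbabilityMeasure Q → IsProbabilityMeasure P →
      ∀ A : Set (Config N), MeasurableSet A → P A ≠ 0 → InformationTheory.klDiv Q P ≠ ⊤ →
        (Q A).toReal * Real.log (1 + (P A).toReal⁻¹) ≤
          Real.log 2 + (InformationTheory.klDiv Q P).toReal := by
  intro N Q P hQ hP A hA hPA hfin
  -- `p := P(A) ∈ (0, 1]`, `c := log (1 + 1/p) ≥ 0`
  set p : ℝ := (P A).toReal with hpdef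
  have hp0 : 0 < p := ENNReal.toReal_pos hPA (measure_ne_top P A)
  have hp1 : 0 < 1 + p⁻¹ := by positivity
  set c : ℝ := Real.log (1 + p⁻¹) with hcdef
  have hc0 : 0 ≤ c := Real.log_nonneg (by linarith [inv_pos.2 hp0])
  -- the bounded measurable test function `ψ = c · 1_A`
  set ψ : Config N → ℝ := A.indicator (fun _ => c) with hψdef
  have hψm : Measurable ψ := measurable_const.indicator hA
  have hψb : ∀ x, |ψ x| ≤ c := by
    intro x
    by_cases hx : x ∈ A
    · simp only [hψdef, Set.indicator_of_mem hx, abs_of_nonneg hc0, le_refl]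
    · simp only [hψdef, Set.indicator_of_notMem hx, abs_zero, hc0]
  have h := Literature.Probability.Divergences.integral_le_toReal_klDiv_add_log hfin hψm hψb
  -- `∫ ψ dQ = Q(A) · c`
  have h1 : ∫ x, ψ x ∂Q = (Q A).toReal * c := by
    rw [hψdef, integral_indicator_const c hA, smul_eq_mul, measureReal_def]
  -- `∫ e^ψ dP = P(A) · (1/p) + 1 = 2`
  have hexp : ∀ x, Real.exp (ψ x) = A.indicator (fun _ => p⁻¹) x + 1 := by
    intro x
    by_cases hx : x ∈ A
    · simp only [hψdef, Set.indicator_of_mem hx, hcdef, Real.exp_log hp1]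
      ring
    · simp only [hψdef, Set.indicator_of_notMem hx, Real.exp_zero, zero_add]
  have h2 : ∫ x, Real.exp (ψ x) ∂P = 2 := by
    simp_rw [hexp]
    rw [integral_add ((integrable_const _).indicator hA) (integrable_const _),
      integral_indicator_const _ hA, integral_const, smul_eq_mul, smul_eq_mul, probReal_univ,
      measureReal_def, ← hpdef, mul_inv_cancel₀ hp0.ne']
    norm_num
  rw [h1, h2] at h
  linarith

end Summit.AtomisticToContinuum.BoseEinsteinCondensation.TorusInTheBox

end
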